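import Literature.NumberTheory.EllipticCurves.ComplexMultiplicationDeuringRamifiedProofs
import Literature.NumberTheory.EllipticCurves.HeegnerPoints
import HarnessLib

/-!
# Crux `PrintCf2.SplitBadTwoRankOneOfFacts` (stmt-BirchSwinnertonDyer-20368), road α v9.1 — S3c₂ piece (ii)-a, file 1/2:
# `j = −3375` ⟹ `W_K` has ADDITIVE reduction at every place above `7` of every quadratic field `K`

Cell `bsd-print-cf2`, LEAD seat `bsd-line-cf2-p1` g11 (prover-bsd-line-cf2-p1-g11-0); `--supports stmt-BirchSwinnertonDyer-20368`
(helper, Theses-free). HONEST FRAMING: nothing here closes the crux or a registered stub; BSD is not proved by any of this; no summit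
statement is proved by this seat. No definition, no named fact, no `sorry`.

WHY. The registered stub S3c₂ `stub_restrictedEulerCharBottom_two` (skeleton of record v9.1 fc726a893a021e04) is the control + bottom
evaluation of Agboola's restricted Selmer group `𝔖_{v̄}(K*_∞, W*)` along THE `ℤ₂`-line `K*_∞/K` unramified outside `v̄`. Agboola 2007
Prop. 3.2 controls the kernel by `W*(K*_∞)`, finite there by the formal group at a GOOD ordinary `𝔭`; at the additive `2` the finiteness
comes instead from an ADDITIVE place INSIDE the unramified set of the line — for the class `C • W = cm7^{(d)}` (`j = −3375`) that place is
the prime of `K` above `7`, for every member and every quadratic `K` (file 2/2, `…RestrictedSelmerKernelFinite`, does the Galois side).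
This file is the reduction-type input:
* `hasAdditiveReductionAt_baseChange_of_integral_model` — the engine of `ComplexMultiplicationDeuringRamifiedProofs` (which exported only
  the local Euler factor) with the REDUCTION TYPE exported and a general ramification index: `W ≅_ℚ M`, `M` integral at `v = w ∩ ℤ`,
  `|Δ(M)|_v = exp(−n)`, `|c₄(M)|_v³ ≤ |Δ(M)|_v`, `12 ∤ e(w|v)·n` ⟹ `W_K` additive at `w` (valuations along `w ∣ v` are `e`-th powers,
  Mathlib `valuation_liesOver`; Silverman *AEC* VII.5.1(c) via the tree's `hasAdditiveReductionAt_of_valuation_Δ_of_cube_le`; invariance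
  under `ℚ`-isomorphism `hasAdditiveReductionAt_smul_iff_holds`);
* `hasAdditiveReductionAt_baseChange_of_j_eq_cm7` — `j(W) = −3375`, `w ∣ 7`, `4 ∤ e(w|7)` ⟹ `W_K` additive at `w` (`W ≅ cm7^{(D)}`,
  `ord₇ Δ = 6 ord₇ D + 3`, `ord₇ j = 0`, so `ord_w Δ = e(6a+3) ∉ 12ℤ`);
* `not_four_dvd_ramificationIdx_of_finrank_eq_two` (`e ≤ [K:ℚ] = 2`, fundamental identity) and
  `hasAdditiveReductionAt_baseChange_of_j_eq_cm7_of_finrank_eq_two`;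
* small helpers for the frame: a place above any rational prime exists (`exists_heightOneSpectrum_natCast_mem`, going-up), a place above
  `7` does not contain `2`, and `j = −3375` for `C • W = cm7^{(d)}`.
presearch: Silverman AEC VII.5.1(c), ATAEC App. A §3 (held); the tree's Deuring-ramified engine — no new fact filed.

References: [SilvermanAEC2009] VII.5 Prop. 5.1(c), VII.1 Prop. 1.3(b), X.5 Prop. 5.4; [SilvermanATAEC1994] App. A §3 (row D = −7);
[Agboola2007] §3 Prop. 3.2.
-/

noncomputable section

open scoped Classical

set_option linter.dupNamespace false
set_option autoImplicit false

open NumberField IsDedekindDomain Field WeierstrassCurve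
open Literature.NumberTheory.EllipticCurves
open Literature.NumberTheory.GaloisRepresentations

universe u

namespace Summit.BirchSwinnertonDyer.BirchSwinnertonDyer.Theorems.PrintCf2.AdditiveAtSeven

/-! ## §1. `j = −3375`: `W_K` has ADDITIVE reduction at every place `w ∣ 7` with `4 ∤ e(w|7)` (every quadratic `K`) -/

section Seven

open Rat.HeightOneSpectrum

variable (K : Type) [Field K] [NumberField K] (w : HeightOneSpectrum (𝓞 K))

/-- Along a place `w` of `K` over the place `v = w ∩ ℤ` of `ℚ`, `|x|_w = |x|_v^{e(w|v)}` for `x ∈ ℚ` (Mathlib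
`valuation_liesOver`). [folklore] -/
theorem valuation_algebraMap_eq_pow_ramificationIdx (x : ℚ) :
    w.valuation K (algebraMap ℚ K x) =
      (w.under (𝓞 ℚ)).valuation ℚ x ^ w.asIdeal.ramificationIdx (𝓞 ℚ) := by
  set v := w.under (𝓞 ℚ) with hv
  haveI : w.asIdeal.LiesOver v.asIdeal := ⟨rfl⟩
  rw [← Ideal.ramificationIdx'_eq_ramificationIdx v.asIdeal w.asIdeal v.ne_bot]
  exact (HeightOneSpectrum.valuation_liesOver K v w x).symm

/-- `12 ∤ e · (6a + 3)` when `4 ∤ e`. [folklore] -/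
theorem not_twelve_dvd_mul_of_not_four_dvd {e a : ℕ} (he : ¬ 4 ∣ e) : ¬ 12 ∣ e * (6 * a + 3) := by
  intro h
  have h4 : 4 ∣ e * (2 * a + 1) := by
    have h3 : 3 * (e * (2 * a + 1)) = e * (6 * a + 3) := by ring
    have : 3 * 4 ∣ 3 * (e * (2 * a + 1)) := by rw [h3]; exact h
    exact Nat.dvd_of_mul_dvd_mul_left (by norm_num) this
  have hcop : Nat.Coprime 4 (2 * a + 1) := by
    have h2 : Nat.Coprime 2 (2 * a + 1) := Nat.coprime_two_left.mpr ⟨a, rfl⟩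
    simpa using Nat.Coprime.pow_left 2 h2
  exact he (hcop.dvd_of_dvd_mul_right h4)

/-- **Additive reduction of the base change from an integral `ℚ`-model** (the engine of
`ComplexMultiplicationDeuringRamifiedProofs`, with the reduction type exported instead of the Euler factor and a general
ramification index): `W ≅_ℚ M` with `M` integral at `v = w ∩ ℤ`, `|Δ(M)|_v = exp(−n)`, `|c₄(M)|_v³ ≤ |Δ(M)|_v` and
`12 ∤ e(w|v)·n` ⟹ `W_K` has additive reduction at `w` (valuations along `w ∣ v` are `e`-th powers; Silverman *AEC* VII.5.1(c)
via `hasAdditiveReductionAt_of_valuation_Δ_of_cube_le`; invariance under `ℚ`-isomorphism `hasAdditiveReductionAt_smul_iff_holds`).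
[cite: SilvermanAEC2009, VII.5 Prop. 5.1(c) and VII.1 Prop. 1.3(b)] -/
theorem hasAdditiveReductionAt_baseChange_of_integral_model (W M : WeierstrassCurve ℚ) [W.IsElliptic]
    (C : VariableChange ℚ) (hWM : C • W = M)
    (h₁ : (w.under (𝓞 ℚ)).valuation ℚ M.a₁ ≤ 1) (h₂ : (w.under (𝓞 ℚ)).valuation ℚ M.a₂ ≤ 1)
    (h₃ : (w.under (𝓞 ℚ)).valuation ℚ M.a₃ ≤ 1) (h₄ : (w.under (𝓞 ℚ)).valuation ℚ M.a₄ ≤ 1)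
    (h₆ : (w.under (𝓞 ℚ)).valuation ℚ M.a₆ ≤ 1) {n : ℕ}
    (hΔ : (w.under (𝓞 ℚ)).valuation ℚ M.Δ = WithZero.exp (-(n : ℤ)))
    (hn : ¬ 12 ∣ w.asIdeal.ramificationIdx (𝓞 ℚ) * n)
    (hc₄ : (w.under (𝓞 ℚ)).valuation ℚ M.c₄ ^ 3 ≤ (w.under (𝓞 ℚ)).valuation ℚ M.Δ) :
    (W.baseChange K).HasAdditiveReductionAt w := by
  set v := w.under (𝓞 ℚ) with hv
  set e := w.asIdeal.ramificationIdx (𝓞 ℚ) with he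
  haveI hM : M.IsElliptic := by rw [← hWM]; infer_instance
  have hval : ∀ x : ℚ, w.valuation K (algebraMap ℚ K x) = v.valuation ℚ x ^ e :=
    valuation_algebraMap_eq_pow_ramificationIdx K w
  have hK₁ : w.valuation K (M.baseChange K).a₁ ≤ 1 := by
    simp only [baseChange, map_a₁, hval]; exact pow_le_one' h₁ e
  have hK₂ : w.valuation K (M.baseChange K).a₂ ≤ 1 := by
    simp only [baseChange, map_a₂, hval]; exact pow_le_one' h₂ e
  have hK₃ : w.valuation K (M.baseChange K).a₃ ≤ 1 := by
    simp only [baseChange, map_a₃, hval]; exact pow_le_one' h₃ e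
  have hK₄ : w.valuation K (M.baseChange K).a₄ ≤ 1 := by
    simp only [baseChange, map_a₄, hval]; exact pow_le_one' h₄ e
  have hK₆ : w.valuation K (M.baseChange K).a₆ ≤ 1 := by
    simp only [baseChange, map_a₆, hval]; exact pow_le_one' h₆ e
  have hKΔ : w.valuation K (M.baseChange K).Δ = WithZero.exp (-((e * n : ℕ) : ℤ)) := by
    rw [baseChange, map_Δ, hval, hΔ, ← WithZero.exp_nsmul]
    congr 1
    push_cast
    ring
  have hKc₄ : w.valuation K (M.baseChange K).c₄ ^ 3 ≤ w.valuation K (M.baseChange K).Δ := by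
    rw [baseChange, map_c₄, map_Δ, hval, hval]
    calc (v.valuation ℚ M.c₄ ^ e) ^ 3 = (v.valuation ℚ M.c₄ ^ 3) ^ e := by
          rw [← pow_mul, ← pow_mul, mul_comm]
      _ ≤ v.valuation ℚ M.Δ ^ e := pow_le_pow_left' hc₄ e
  have haddK : (M.baseChange K).HasAdditiveReductionAt w :=
    hasAdditiveReductionAt_of_valuation_Δ_of_cube_le w (M.baseChange K) hK₁ hK₂ hK₃ hK₄ hK₆ hKΔ hn hKc₄
  -- transfer along `C • W = M`
  haveI : (W.baseChange K).IsElliptic := by rw [baseChange]; infer_instance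
  have hsmul : (C.map (algebraMap ℚ K)) • (W.baseChange K) = M.baseChange K := by
    rw [← hWM, baseChange, baseChange, map_variableChange]
  rw [← hsmul] at haddK
  exact (hasAdditiveReductionAt_smul_iff_holds w (W.baseChange K) (C.map (algebraMap ℚ K))).mp haddK

/-- **`j(W) = −3375` ⟹ `W_K` is additive at every `w ∣ 7` with `4 ∤ e(w|7)`.** Every such `W/ℚ` is `ℚ`-isomorphic to a
quadratic twist `cm7^{(D)}`, `D ∈ ℤ ∖ {0}`, of the minimal CM curve `cm7` (`Δ = −7³`, `c₄ = 7·15`; Silverman *AEC* X.5.4 and *ATAEC*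
App. A §3), whose coefficients are integral at `7` with `ord₇ Δ = 6·ord₇ D + 3`, `ord₇ j ≥ 0`; so `ord_w Δ = e(6a + 3) ∉ 12ℤ`.
[cite: SilvermanAEC2009, X.5 Prop. 5.4 with VII.5 Prop. 5.1(c)] [cite: SilvermanATAEC1994, App. A §3 (row D = −7)] -/
theorem hasAdditiveReductionAt_baseChange_of_j_eq_cm7 (W : WeierstrassCurve ℚ) [W.IsElliptic] (hj : W.j = -3375)
    (h7 : natGenerator (w.under (𝓞 ℚ)) = 7) (he : ¬ 4 ∣ w.asIdeal.ramificationIdx (𝓞 ℚ)) :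
    (W.baseChange K).HasAdditiveReductionAt w := by
  set v := w.under (𝓞 ℚ) with hv
  have hp2 : natGenerator v ≠ 2 := by rw [h7]; norm_num
  obtain ⟨hΔ₀, hc₄₀⟩ := valuation_data_of_Δ_eq_neg_cube cm7 v (c' := 15)
    (by rw [h7, Δ_cm7]; push_cast; ring)
    (by rw [h7]; norm_num [cm7, WeierstrassCurve.c₄, WeierstrassCurve.b₂, WeierstrassCurve.b₄])
  have hjW : W.j = cm7.j := by rw [hj, j_cm7]
  -- `W ≅ cm7^{(d)} ≅ cm7^{(D)}`, `D = num(d) den(d) ∈ ℤ`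
  obtain ⟨d, hd, C, hC⟩ := exists_variableChange_eq_quadraticTwist_of_j_eq' hjW (by rw [hj]; norm_num)
    (by rw [hj]; norm_num)
  have hden : (d.den : ℚ) ≠ 0 := by exact_mod_cast d.den_nz
  obtain ⟨C', hC'⟩ := cm7.exists_variableChange_quadraticTwist_mul_sq d d.den hden
  set D : ℤ := d.num * d.den with hD_def
  have hdD : d * (d.den : ℚ) ^ 2 = (D : ℚ) := by
    rw [hD_def, Int.cast_mul, Int.cast_natCast, ← Rat.mul_den_eq_num d]
    ring
  have hD0 : D ≠ 0 := mul_ne_zero (Rat.num_ne_zero.mpr hd) (by exact_mod_cast d.den_nz)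
  have hWM : (C' * C) • W = cm7.quadraticTwist (D : ℚ) := by
    rw [mul_smul, hC, hC', hdD]
  obtain ⟨a, ha⟩ := Rat.exists_valuation_intCast_eq v hD0
  obtain ⟨h₂, h₄, h₆⟩ := valuation_quadraticTwist_le_one_of_odd cm7 (B₂ := -3) (B₄ := -4) (B₆ := -4)
      (by norm_num [cm7, WeierstrassCurve.b₂]) (by norm_num [cm7, WeierstrassCurve.b₄])
      (by norm_num [cm7, WeierstrassCurve.b₆]) v hp2 D
  have hΔ : v.valuation ℚ (cm7.quadraticTwist (D : ℚ)).Δ = WithZero.exp (-((6 * a + 3 : ℕ) : ℤ)) := by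
    rw [quadraticTwist_Δ, Valuation.map_mul, Valuation.map_pow, ha, hΔ₀, ← WithZero.exp_nsmul,
      ← WithZero.exp_add]
    congr 1
    push_cast
    ring
  have hc₄ : v.valuation ℚ (cm7.quadraticTwist (D : ℚ)).c₄ ^ 3 ≤
      v.valuation ℚ (cm7.quadraticTwist (D : ℚ)).Δ := by
    rw [quadraticTwist_c₄, quadraticTwist_Δ, Valuation.map_mul, Valuation.map_mul,
      Valuation.map_pow, Valuation.map_pow, mul_pow, ← pow_mul]
    exact mul_le_mul_right hc₄₀ _
  exact hasAdditiveReductionAt_baseChange_of_integral_model K w W _ (C' * C) hWM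
    (by rw [quadraticTwist_a₁, Valuation.map_zero]; exact zero_le)
    h₂ (by rw [quadraticTwist_a₃, Valuation.map_zero]; exact zero_le) h₄ h₆ hΔ
    (not_twelve_dvd_mul_of_not_four_dvd he) hc₄

/-- For a quadratic number field every ramification index over `ℚ` is `≤ 2`, in particular `4 ∤ e(w|p)`
(fundamental identity, Mathlib `Ideal.ramificationIdx_le_finrank`). [folklore] -/
theorem not_four_dvd_ramificationIdx_of_finrank_eq_two (hK : Module.finrank ℚ K = 2) :
    ¬ 4 ∣ w.asIdeal.ramificationIdx (𝓞 ℚ) := by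
  set v := w.under (𝓞 ℚ) with hv
  haveI : w.asIdeal.LiesOver v.asIdeal := ⟨rfl⟩
  haveI : NoZeroSMulDivisors (𝓞 ℚ) (𝓞 K) := ⟨fun {c x} h ↦ by
    rw [Algebra.smul_def, mul_eq_zero] at h
    exact h.imp_left fun hc ↦ FaithfulSMul.algebraMap_injective (𝓞 ℚ) (𝓞 K) (by rw [hc, map_zero])⟩
  have hle : w.asIdeal.ramificationIdx (𝓞 ℚ) ≤ Module.finrank ℚ K := by
    rw [← Ideal.ramificationIdx'_eq_ramificationIdx v.asIdeal w.asIdeal v.ne_bot]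
    exact Ideal.ramificationIdx_le_finrank (𝓞 K) ℚ K w.asIdeal (p := v.asIdeal)
  have hne : w.asIdeal.ramificationIdx (𝓞 ℚ) ≠ 0 := by
    rw [← Ideal.ramificationIdx'_eq_ramificationIdx v.asIdeal w.asIdeal v.ne_bot]
    exact Ideal.IsDedekindDomain.ramificationIdx'_ne_zero_of_liesOver w.asIdeal v.ne_bot
  omega

/-- **On a quadratic field: `j(W) = −3375` ⟹ `W_K` is additive at every place above `7`.**
[cite: SilvermanAEC2009, X.5 Prop. 5.4 with VII.5 Prop. 5.1(c)] [cite: SilvermanATAEC1994, App. A §3 (row D = −7)] -/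
theorem hasAdditiveReductionAt_baseChange_of_j_eq_cm7_of_finrank_eq_two (hK : Module.finrank ℚ K = 2)
    (W : WeierstrassCurve ℚ) [W.IsElliptic] (hj : W.j = -3375) (h7 : ((7 : ℕ) : 𝓞 K) ∈ w.asIdeal) :
    (W.baseChange K).HasAdditiveReductionAt w := by
  have h7v : ((7 : ℕ) : 𝓞 ℚ) ∈ (w.under (𝓞 ℚ)).asIdeal := by
    change algebraMap (𝓞 ℚ) (𝓞 K) ((7 : ℕ) : 𝓞 ℚ) ∈ w.asIdeal
    rwa [map_natCast]
  have hdvd : natGenerator (w.under (𝓞 ℚ)) ∣ 7 := (Rat.natCast_mem_asIdeal_iff _).mp h7v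
  exact hasAdditiveReductionAt_baseChange_of_j_eq_cm7 K w W hj
    ((Nat.prime_dvd_prime_iff_eq (prime_natGenerator _) (by norm_num)).mp hdvd)
    (not_four_dvd_ramificationIdx_of_finrank_eq_two K w hK)

end Seven

/-! ## §2. Helpers for the road-α frame: a place above `7`, coprimality with `2`, `j = −3375` on the class -/

section Helpers

open Rat.HeightOneSpectrum

variable {K : Type} [Field K] [NumberField K]

/-- Every number field has a finite place above `7` (above any rational prime): a maximal ideal of `𝓞 K` over `7ℤ`
(going up for the integral extension `ℤ → 𝓞 K`). [folklore] -/
theorem exists_heightOneSpectrum_natCast_mem {q : ℕ} (hq : q.Prime) :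
    ∃ w : HeightOneSpectrum (𝓞 K), ((q : ℕ) : 𝓞 K) ∈ w.asIdeal := by
  set P : Ideal ℤ := Ideal.span {(q : ℤ)} with hP
  have hP0 : P ≠ ⊥ := by simpa [hP] using (Int.natCast_ne_zero.mpr hq.ne_zero)
  haveI : P.IsMaximal := ((Ideal.span_singleton_prime (Int.natCast_ne_zero.mpr hq.ne_zero)).mpr
      (Nat.prime_iff_prime_int.mp hq)).isMaximal hP0
  obtain ⟨Q, hQm, hQ⟩ := Ideal.exists_maximal_ideal_liesOver_of_isIntegral (S := 𝓞 K) P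
  have hqQ : ((q : ℕ) : 𝓞 K) ∈ Q := by
    have h : (q : ℤ) ∈ Q.under ℤ := by rw [← hQ.over, hP]; exact Ideal.mem_span_singleton_self _
    rw [Ideal.under_def, Ideal.mem_comap, map_natCast] at h
    exact h
  have hQ0 : Q ≠ ⊥ := fun h0 ↦ by
    rw [h0, Submodule.mem_bot] at hqQ
    exact hq.ne_zero (by exact_mod_cast hqQ)
  exact ⟨⟨Q, hQm.isPrime, hQ0⟩, hqQ⟩

omit [NumberField K] in
/-- Two places containing coprime rational integers are distinct; in particular a place above `7` is not above `2` and
does not contain `2`. [folklore] -/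
theorem natCast_two_notMem_of_seven_mem (w : HeightOneSpectrum (𝓞 K)) (h7 : ((7 : ℕ) : 𝓞 K) ∈ w.asIdeal) :
    ((2 : ℕ) : 𝓞 K) ∉ w.asIdeal := by
  intro h2
  have h1 : (1 : 𝓞 K) ∈ w.asIdeal := by
    have h := w.asIdeal.sub_mem h7 (w.asIdeal.mul_mem_left (3 : 𝓞 K) h2)
    have e : ((7 : ℕ) : 𝓞 K) - 3 * ((2 : ℕ) : 𝓞 K) = 1 := by push_cast; ring
    rwa [e] at h
  exact w.isPrime.ne_top ((Ideal.eq_top_iff_one _).mpr h1)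

/-- `j(W) = −3375` for a member `C • W = cm7^{(d)}`, `d ≠ 0`. [cite: SilvermanATAEC1994, App. A §3 (row D = −7)] -/
theorem j_eq_of_smul_eq_cm7Twist {d : ℤ} (hd0 : d ≠ 0) (W : WeierstrassCurve ℚ) [W.IsElliptic]
    (C : VariableChange ℚ) (hC : C • W = cm7.quadraticTwist (d : ℚ)) : W.j = -3375 := by
  have hdQ : (d : ℚ) ≠ 0 := by exact_mod_cast hd0
  haveI := cm7.isElliptic_quadraticTwist hdQ
  have key : ∀ (V : WeierstrassCurve ℚ) [V.IsElliptic], V = cm7.quadraticTwist (d : ℚ) → V.j = -3375 := by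
    rintro V _ rfl
    rw [j_quadraticTwist cm7 hdQ, j_cm7]
  rw [← variableChange_j W C]
  exact key (C • W) hC

end Helpers

end Summit.BirchSwinnertonDyer.BirchSwinnertonDyer.Theorems.PrintCf2.AdditiveAtSeven

end
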